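import Summits.AtomisticToContinuum.Crystallization.Theorems.OverbindingBudgetAffineStableDescentA

/-!
# NODE g103 «StableDescent» (lens-4), part B — the census glue, `CoarseMid` from the six pieces, the record seams with `CalmRigidity` ABSENT

`CoarseMid ⟸ AgitGain ∧ DilatedDeepT t ∧ SoftGain ∧ StableRigidity t ∧ LooseCalm ∧ OpticCalm` for every `t ≤ 21/20` (`coarseMid_of_stable_pieces`),
and the first-order variant `CoarseMid ⟸ AgitGain ∧ DilatedDeepT t ∧ CalmRigidityT t ∧ LooseCalm ∧ OpticCalm` (`coarseMid_of_tight_pieces`); the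
record instance `t = 1`; the record seam `interfaceDominance_of_swapWide30_stable` and the cone `rdef_of_ceg_shape_stableDescent_record` (tree cone
`rdef_of_ceg_shape_strainBand_record` BY NAME; `CalmRigidity` does not occur among the hypotheses); and the consistency fact that
(413)'s five pieces still give `CoarseMid` through this file (`CalmRigidity ⇒ CalmRigidityT (21/20)`, `DilatedDeep ⇒ DilatedDeepT (21/20)`; the
re-derivation has the statement of the landed (413) `coarseMid_of_pieces`, so it is recorded as a comment, not re-declared — gate dedup rule).

POINTWISE NORMAL FORM (part A + (413) BY NAME): a MID site at depth `L + 128/δ` is either not calm — then within `2L` there is an off-window, a dilated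
(`nn > 21/20 ≥ t`) or an agitated site ((413) `exists_witness_of_not_calm`) —, or calm with an unguarded ball — then within `2L` an in-window `64`-deep
guard-bad site (`exists_guardBad_of_calm`; for the stable guard: dilated past `t` or locally unstable) —, or guarded-calm — then within `24` a loose or an
optic calm site (`exists_loose_or_optic_of_calmG_mid`, rigidity used only on guarded balls).  Packing (`natCard_le_mul_of_witness`) three times, the five
W-censuses added (`censusW_add`), the depth returned to `64` (`affMidCount_depth_le`, `notDeepCount_depth_le`).  LEAF SET of the 31280 line (2c) through
this node: `SW♭₃₀ ∧ MildBand ∧ StrongBand ∧ AgitGain ∧ DilatedDeepT 1 ∧ SoftGain ∧ StableRigidity 1 ∧ LooseCalm ∧ OpticCalm ∧ ThinFault`.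
MUST-FAIL probes and `#h21_crux_probe` verdicts: `HOME/decomp-a2c-lens-4/g103/bc/`.
-/

namespace Summit.AtomisticToContinuum.Crystallization.Theorems.OverbindingBudgetAffineStableDescent

open scoped BigOperators Classical
open Literature.MathematicalPhysics.StatisticalMechanics
open Literature.Geometry.DiscreteGeometry (IsChargeFree nearestDist nearestDist_nonneg nearestDist_le_dist fccTwoShellPattern hcpTwoShellPattern
  bondGraph)
open Summit.AtomisticToContinuum.Crystallization.Theorems.OverbindingBudgetMisfitCensusStatements (Bad Short Long)
open Summit.AtomisticToContinuum.Crystallization.Theorems.OverbindingBudgetMisfitRegistration (Framed Reg DeepReg regScaleCount)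
open Summit.AtomisticToContinuum.Crystallization.Theorems.OverbindingBudgetMisfitWindowStatements (InWindow offCount)
open Summit.AtomisticToContinuum.Crystallization.Theorems.OverbindingBudgetBalancedCensusStatements
open Summit.AtomisticToContinuum.Crystallization.Theorems.OverbindingBudgetAffineLadder
open Summit.AtomisticToContinuum.Crystallization.Theorems.OverbindingBudgetAffineMesoCut
open Summit.AtomisticToContinuum.Crystallization.Theorems.OverbindingBudgetAffinePhaseCut
open Summit.AtomisticToContinuum.Crystallization.Theorems.OverbindingBudgetAffineCushionCut
open Summit.AtomisticToContinuum.Crystallization.Theorems.OverbindingBudgetAffineTwinCut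
open Summit.AtomisticToContinuum.Crystallization.Theorems.OverbindingBudgetAffineRunCut
open Summit.AtomisticToContinuum.Crystallization.Theorems.OverbindingBudgetAffineCompressedCut
open Summit.AtomisticToContinuum.Crystallization.Theorems.OverbindingBudgetAffineRunCutFlat
open Summit.AtomisticToContinuum.Crystallization.Theorems.OverbindingBudgetAffineWildCut
open Summit.AtomisticToContinuum.Crystallization.Theorems.OverbindingBudgetAffineCoreDescent
open Summit.AtomisticToContinuum.Crystallization.Theorems.OverbindingBudgetAffineStrainBand
open Summit.AtomisticToContinuum.Crystallization.Theorems.OverbindingBudgetAffineCalmDescent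

variable {N : ℕ}

/-! ## §6  The three-way split at one configuration (PROVED) -/

/-- **THE POINTWISE NORMAL FORM WITH A GUARD.**  At MID depth `L⁺ = L + 128/δ` (calm depth `L ≥ 12 + 128/δ`), guarded rigidity at calm depth `L₀`,
witness depth `R ≥ 0` with `R + 2L₀/δ ≤ (L − 12)δ/2`:
`#MID(L⁺) ≤ 27(4L+δ)³/δ³ · (#off + #dilated + #agitated + #guardBad) + 27(48+δ)³/δ³ · (#looseCalm + #opticCalm)(δ, η₂, τ, R) + 3·#off`. [this node] -/
theorem affMidCount_le_guard_split {G : ∀ {N : ℕ}, (Fin N → EuclideanSpace ℝ (Fin 3)) → Fin N → Prop} {δ τ L L₀ R η₂ : ℝ} (hδ : 0 < δ)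
    (hL₀ : 0 ≤ L₀) (hR : 0 ≤ R) (hL : 12 + 128 / δ ≤ L) (hLR : R + 2 * L₀ / δ ≤ (L - 12) * δ / 2) {y : Fin N → EuclideanSpace ℝ (Fin 3)}
    (hy : Function.Injective y) (hrig : ∀ i : Fin N, CalmG G δ τ L₀ y i → OptDeepReg 12 η₂ (1 / 10) (1 / 450) y i) :
    (affMidCount (L + 128 / δ) 12 (1 / 10 ^ 4) (1 / 25) (3 / 50) (1 / 450) y : ℝ) ≤
      27 / δ ^ 3 * (2 * (2 * L) + δ) ^ 3 * (offCount δ 2 y + dilatedCount δ y + agitCount δ τ y + guardBadCount G δ y)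
        + 27 / δ ^ 3 * (2 * 24 + δ) ^ 3 * (looseCalmCount δ η₂ τ R y + opticCalmCount δ η₂ τ R y)
        + 3 * offCount δ 2 y := by
  have h128 : 0 ≤ 128 / δ := div_nonneg (by norm_num) hδ.le
  have hL0 : 0 ≤ L := by linarith
  set Ka : ℝ := 27 / δ ^ 3 * (2 * (2 * L) + δ) ^ 3 with hKa
  set Kb : ℝ := 27 / δ ^ 3 * (2 * 24 + δ) ^ 3 with hKb
  have hKa0 : 0 ≤ Ka := by
    rw [hKa]; exact mul_nonneg (div_nonneg (by norm_num) (pow_nonneg hδ.le 3)) (pow_nonneg (by linarith) 3)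
  have hKb0 : 0 ≤ Kb := by
    rw [hKb]; exact mul_nonneg (div_nonneg (by norm_num) (pow_nonneg hδ.le 3)) (pow_nonneg (by linarith) 3)
  -- (1) excluded middle on calmness, then on the guard
  have h1 : affMidCount (L + 128 / δ) 12 (1 / 10 ^ 4) (1 / 25) (3 / 50) (1 / 450) y ≤
      Nat.card {i // (DeepReg (L + 128 / δ) (3 / 50) (1 / 450) y i ∧ ¬ AffDeepReg 12 (1 / 10 ^ 4) (1 / 25) (1 / 450) y i) ∧ CalmG G δ τ L y i}
      + Nat.card {i // (DeepReg (L + 128 / δ) (3 / 50) (1 / 450) y i ∧ ¬ AffDeepReg 12 (1 / 10 ^ 4) (1 / 25) (1 / 450) y i) ∧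
          (Calm δ τ L y i ∧ ¬ BallGuard G L y i)}
      + Nat.card {i // (DeepReg (L + 128 / δ) (3 / 50) (1 / 450) y i ∧ ¬ AffDeepReg 12 (1 / 10 ^ 4) (1 / 25) (1 / 450) y i) ∧ ¬ Calm δ τ L y i} := by
    unfold affMidCount
    have ha := natCard_le_add_of_imp
      (P := fun i => DeepReg (L + 128 / δ) (3 / 50) (1 / 450) y i ∧ ¬ AffDeepReg 12 (1 / 10 ^ 4) (1 / 25) (1 / 450) y i)
      (Q := fun i => (DeepReg (L + 128 / δ) (3 / 50) (1 / 450) y i ∧ ¬ AffDeepReg 12 (1 / 10 ^ 4) (1 / 25) (1 / 450) y i) ∧ Calm δ τ L y i)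
      (R := fun i => (DeepReg (L + 128 / δ) (3 / 50) (1 / 450) y i ∧ ¬ AffDeepReg 12 (1 / 10 ^ 4) (1 / 25) (1 / 450) y i) ∧ ¬ Calm δ τ L y i)
      fun i hi => by
        by_cases hc : Calm δ τ L y i
        · exact Or.inl ⟨hi, hc⟩
        · exact Or.inr ⟨hi, hc⟩
    have hb := natCard_le_add_of_imp
      (P := fun i => (DeepReg (L + 128 / δ) (3 / 50) (1 / 450) y i ∧ ¬ AffDeepReg 12 (1 / 10 ^ 4) (1 / 25) (1 / 450) y i) ∧ Calm δ τ L y i)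
      (Q := fun i => (DeepReg (L + 128 / δ) (3 / 50) (1 / 450) y i ∧ ¬ AffDeepReg 12 (1 / 10 ^ 4) (1 / 25) (1 / 450) y i) ∧ CalmG G δ τ L y i)
      (R := fun i => (DeepReg (L + 128 / δ) (3 / 50) (1 / 450) y i ∧ ¬ AffDeepReg 12 (1 / 10 ^ 4) (1 / 25) (1 / 450) y i) ∧
        (Calm δ τ L y i ∧ ¬ BallGuard G L y i))
      fun i hi => by
        by_cases hg : BallGuard G L y i
        · exact Or.inl ⟨hi.1, hi.2, hg⟩
        · exact Or.inr ⟨hi.1, hi.2, hg⟩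
    omega
  -- (2) guarded-calm MID sites: a loose or optic calm witness within `24`
  have h2 : (Nat.card {i // (DeepReg (L + 128 / δ) (3 / 50) (1 / 450) y i ∧ ¬ AffDeepReg 12 (1 / 10 ^ 4) (1 / 25) (1 / 450) y i) ∧
        CalmG G δ τ L y i} : ℝ) ≤
      Kb * Nat.card {j // LooseCalmSite δ η₂ τ R y j ∨ OpticCalmSite δ η₂ τ R y j} + offCount δ 2 y := by
    rw [hKb]
    refine natCard_le_mul_of_witness hδ (by norm_num) hy fun i _ hP => ?_
    exact exists_loose_or_optic_of_calmG_mid hδ hL₀ hR hL hLR hrig hP.2 hP.1.2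
  have h2' : Nat.card {j // LooseCalmSite δ η₂ τ R y j ∨ OpticCalmSite δ η₂ τ R y j} ≤
      looseCalmCount δ η₂ τ R y + opticCalmCount δ η₂ τ R y := by
    unfold looseCalmCount opticCalmCount
    exact natCard_le_add_of_imp fun j hj => hj
  -- (3) calm MID sites with an unguarded ball: a guard-bad witness within `2L`
  have h3 : (Nat.card {i // (DeepReg (L + 128 / δ) (3 / 50) (1 / 450) y i ∧ ¬ AffDeepReg 12 (1 / 10 ^ 4) (1 / 25) (1 / 450) y i) ∧
        (Calm δ τ L y i ∧ ¬ BallGuard G L y i)} : ℝ) ≤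
      Ka * Nat.card {j // InWindow δ 2 y j ∧ DeepReg 64 (3 / 50) (1 / 450) y j ∧ ¬ G y j} + offCount δ 2 y := by
    rw [hKa]
    refine natCard_le_mul_of_witness hδ (by linarith) hy fun i hw hP => ?_
    exact exists_guardBad_of_calm hδ hL0 hw hP.1.1 hP.2.1 hP.2.2
  have h3' : Nat.card {j // InWindow δ 2 y j ∧ DeepReg 64 (3 / 50) (1 / 450) y j ∧ ¬ G y j} = guardBadCount G δ y := rfl
  -- (4) non-calm MID sites: an off-window, dilated or agitated witness within `2L` ((413) BY NAME)
  have h4 : (Nat.card {i // (DeepReg (L + 128 / δ) (3 / 50) (1 / 450) y i ∧ ¬ AffDeepReg 12 (1 / 10 ^ 4) (1 / 25) (1 / 450) y i) ∧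
        ¬ Calm δ τ L y i} : ℝ) ≤
      Ka * Nat.card {j // ¬ InWindow δ 2 y j ∨ (Dilated δ y j ∨ Agitated δ τ y j)} + offCount δ 2 y := by
    rw [hKa]
    refine natCard_le_mul_of_witness hδ (by linarith) hy fun i hw hP => ?_
    exact exists_witness_of_not_calm hδ hL0 hw hP.1.1 hP.2
  have h4' : Nat.card {j // ¬ InWindow δ 2 y j ∨ (Dilated δ y j ∨ Agitated δ τ y j)} ≤
      offCount δ 2 y + (dilatedCount δ y + agitCount δ τ y) := by
    have ha : Nat.card {j // ¬ InWindow δ 2 y j ∨ (Dilated δ y j ∨ Agitated δ τ y j)} ≤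
        Nat.card {j // ¬ InWindow δ 2 y j} + Nat.card {j // Dilated δ y j ∨ Agitated δ τ y j} :=
      natCard_le_add_of_imp fun j hj => hj
    have hb : Nat.card {j // Dilated δ y j ∨ Agitated δ τ y j} ≤ dilatedCount δ y + agitCount δ τ y := by
      unfold dilatedCount agitCount
      exact natCard_le_add_of_imp fun j hj => hj
    have hc : Nat.card {j // ¬ InWindow δ 2 y j} = offCount δ 2 y := rfl
    omega
  -- (5) assemble over ℝ
  have h1r : (affMidCount (L + 128 / δ) 12 (1 / 10 ^ 4) (1 / 25) (3 / 50) (1 / 450) y : ℝ) ≤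
      (Nat.card {i // (DeepReg (L + 128 / δ) (3 / 50) (1 / 450) y i ∧ ¬ AffDeepReg 12 (1 / 10 ^ 4) (1 / 25) (1 / 450) y i) ∧ CalmG G δ τ L y i} : ℝ)
      + (Nat.card {i // (DeepReg (L + 128 / δ) (3 / 50) (1 / 450) y i ∧ ¬ AffDeepReg 12 (1 / 10 ^ 4) (1 / 25) (1 / 450) y i) ∧
          (Calm δ τ L y i ∧ ¬ BallGuard G L y i)} : ℝ)
      + (Nat.card {i // (DeepReg (L + 128 / δ) (3 / 50) (1 / 450) y i ∧ ¬ AffDeepReg 12 (1 / 10 ^ 4) (1 / 25) (1 / 450) y i) ∧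
          ¬ Calm δ τ L y i} : ℝ) := by
    exact_mod_cast h1
  have h2r : (Nat.card {j // LooseCalmSite δ η₂ τ R y j ∨ OpticCalmSite δ η₂ τ R y j} : ℝ) ≤
      (looseCalmCount δ η₂ τ R y : ℝ) + (opticCalmCount δ η₂ τ R y : ℝ) := by
    exact_mod_cast h2'
  have h3r : (Nat.card {j // InWindow δ 2 y j ∧ DeepReg 64 (3 / 50) (1 / 450) y j ∧ ¬ G y j} : ℝ) = (guardBadCount G δ y : ℝ) := by
    exact_mod_cast h3'
  have h4r : (Nat.card {j // ¬ InWindow δ 2 y j ∨ (Dilated δ y j ∨ Agitated δ τ y j)} : ℝ) ≤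
      (offCount δ 2 y : ℝ) + ((dilatedCount δ y : ℝ) + (agitCount δ τ y : ℝ)) := by
    exact_mod_cast h4'
  have e2 := mul_le_mul_of_nonneg_left h2r hKb0
  have e4 := mul_le_mul_of_nonneg_left h4r hKa0
  rw [h3r] at h3
  linarith

/-! ## §7  The census glue (PROVED): one window with a fixed guard, then `CoarseMid` -/

/-- **One window, fixed guard `G`.**  From the δ-instances of `LooseCalm` / `OpticCalm` (dials `ηL, τL, LL` / `ηO, τO, LO`), guarded rigidity at the common
precision `η₂ ≤ min ηL ηO` from calm depth `L₀` with force tolerance `τ₀`, the agitation census at every `τ > 0`, the (413)-dilation census and the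
guard-bad census at `δ`: the MID census `BalancedAffMidGapW 64 12 (1/10⁴) (1/25) (3/50) (1/450) δ 2`.  Dials as in (413) `coarseMid_of_pieces`. [this node] -/
theorem affMidGapW_of_guard {G : ∀ {N : ℕ}, (Fin N → EuclideanSpace ℝ (Fin 3)) → Fin N → Prop} {δ η₂ ηL ηO τ₀ L₀ τL LL τO LO : ℝ}
    (hδ : 0 < δ) (hδ2 : δ ≤ 2) (hτ₀ : 0 < τ₀) (hL₀ : 0 ≤ L₀) (hτL : 0 < τL) (hτO : 0 < τO) (hηL : η₂ ≤ ηL) (hηO : η₂ ≤ ηO)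
    (hrig : ∀ (N : ℕ) (y : Fin N → EuclideanSpace ℝ (Fin 3)), Function.Injective y →
      ∀ i : Fin N, CalmG G δ τ₀ L₀ y i → OptDeepReg 12 η₂ (1 / 10) (1 / 450) y i)
    (hbandL : ∀ τ L : ℝ, 0 < τ → τ ≤ τL → LL ≤ L →
      CensusW (fun y => looseCalmCount δ ηL τ L y) (fun y => notDeepCount 64 (3 / 50) (1 / 450) y) δ 2)
    (hbandO : ∀ τ L : ℝ, 0 < τ → τ ≤ τO → LO ≤ L →
      CensusW (fun y => opticCalmCount δ ηO τ L y) (fun y => notDeepCount 64 (3 / 50) (1 / 450) y) δ 2)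
    (hAg : ∀ τ : ℝ, 0 < τ → CensusW (fun y => agitCount δ τ y) (fun y => notDeepCount 64 (3 / 50) (1 / 450) y) δ 2)
    (hDi : CensusW (fun y => dilatedCount δ y) (fun y => notDeepCount 64 (3 / 50) (1 / 450) y) δ 2)
    (hGb : CensusW (fun y => guardBadCount G δ y) (fun y => notDeepCount 64 (3 / 50) (1 / 450) y) δ 2) :
    BalancedAffMidGapW 64 12 (1 / 10 ^ 4) (1 / 25) (3 / 50) (1 / 450) δ 2 := by
  have h128 : 0 ≤ 128 / δ := div_nonneg (by norm_num) hδ.le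
  -- the common parameters
  set τ : ℝ := min τ₀ (min τL τO) with hτ
  set M : ℝ := max (max LL LO) 0 with hM
  set L : ℝ := max L₀ (12 + 2 * (M + 2 * L₀ / δ + 64) / δ) with hLdef
  have hτpos : 0 < τ := lt_min hτ₀ (lt_min hτL hτO)
  have hτ0 : τ ≤ τ₀ := min_le_left _ _
  have hτL' : τ ≤ τL := (min_le_right _ _).trans (min_le_left _ _)
  have hτO' : τ ≤ τO := (min_le_right _ _).trans (min_le_right _ _)
  have hM0 : 0 ≤ M := le_max_right _ _
  have hMLL : LL ≤ M := (le_max_left _ _).trans (le_max_left _ _)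
  have hMLO : LO ≤ M := (le_max_right _ _).trans (le_max_left _ _)
  have hA0 : 0 ≤ 2 * L₀ / δ := div_nonneg (by linarith) hδ.le
  have hLge : 12 + 2 * (M + 2 * L₀ / δ + 64) / δ ≤ L := le_max_right _ _
  have hL12 : 12 + 128 / δ ≤ L := by
    have hδle : 0 ≤ δ := hδ.le
    have h2 : 128 / δ ≤ 2 * (M + 2 * L₀ / δ + 64) / δ := by
      gcongr
      linarith
    linarith
  have hLR : M + 2 * L₀ / δ ≤ (L - 12) * δ / 2 := by
    have h2 : 2 * (M + 2 * L₀ / δ + 64) / δ * δ = 2 * (M + 2 * L₀ / δ + 64) := div_mul_cancel₀ _ hδ.ne'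
    have h3 : (L - 12) * δ ≥ 2 * (M + 2 * L₀ / δ + 64) / δ * δ := by nlinarith
    linarith
  -- guarded rigidity at the common `τ`, from calm depth `L₀`
  have hrig' : ∀ (N : ℕ) (y : Fin N → EuclideanSpace ℝ (Fin 3)), Function.Injective y →
      ∀ i : Fin N, CalmG G δ τ L₀ y i → OptDeepReg 12 η₂ (1 / 10) (1 / 450) y i :=
    fun N y hy i hc => hrig N y hy i (calmG_anti hτ0 le_rfl hc)
  -- the two calm censuses at the common parameters (`η₂`-monotonicity)
  have hLoW : CensusW (fun y => looseCalmCount δ η₂ τ M y) (fun y => notDeepCount 64 (3 / 50) (1 / 450) y) δ 2 := by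
    refine censusW_mono (fun y => ?_) (fun _ => le_rfl) (hbandL τ M hτpos hτL' hMLL)
    unfold looseCalmCount
    exact natCard_le_of_imp fun i hi => ⟨hi.1, hi.2.1, optDeepReg_mono le_rfl hηL hi.2.2.1, hi.2.2.2⟩
  have hOpW : CensusW (fun y => opticCalmCount δ η₂ τ M y) (fun y => notDeepCount 64 (3 / 50) (1 / 450) y) δ 2 := by
    refine censusW_mono (fun y => ?_) (fun _ => le_rfl) (hbandO τ M hτpos hτO' hMLO)
    unfold opticCalmCount
    exact natCard_le_of_imp fun i hi => ⟨hi.1, hi.2.1, optDeepReg_mono le_rfl hηO hi.2.2.1, hi.2.2.2⟩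
  -- one window at MID depth `L + 128/δ`
  have hsum := censusW_add (censusW_add (censusW_add (censusW_add (hAg τ hτpos) hDi) hGb) hLoW) hOpW
  set Ka : ℝ := 27 / δ ^ 3 * (2 * (2 * L) + δ) ^ 3 with hKa
  set Kb : ℝ := 27 / δ ^ 3 * (2 * 24 + δ) ^ 3 with hKb
  have hKa0 : 0 ≤ Ka := by
    rw [hKa]; exact mul_nonneg (div_nonneg (by norm_num) (pow_nonneg hδ.le 3)) (pow_nonneg (by linarith) 3)
  have hKb0 : 0 ≤ Kb := by
    rw [hKb]; exact mul_nonneg (div_nonneg (by norm_num) (pow_nonneg hδ.le 3)) (pow_nonneg (by linarith) 3)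
  have hW : CensusW (fun y => affMidCount (L + 128 / δ) 12 (1 / 10 ^ 4) (1 / 25) (3 / 50) (1 / 450) y)
      (fun y => notDeepCount 64 (3 / 50) (1 / 450) y) δ 2 := by
    refine censusW_of_le_mul (K := Ka + Kb + 3) (by linarith) (fun y hy => ?_) hsum
    have h := affMidCount_le_guard_split hδ hL₀ hM0 hL12 hLR hy (hrig' _ y hy)
    rw [← hKa, ← hKb] at h
    have n1 : (0 : ℝ) ≤ offCount δ 2 y := Nat.cast_nonneg _
    have n2 : (0 : ℝ) ≤ dilatedCount δ y := Nat.cast_nonneg _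
    have n3 : (0 : ℝ) ≤ agitCount δ τ y := Nat.cast_nonneg _
    have n4 : (0 : ℝ) ≤ looseCalmCount δ η₂ τ M y := Nat.cast_nonneg _
    have n5 : (0 : ℝ) ≤ opticCalmCount δ η₂ τ M y := Nat.cast_nonneg _
    have n6 : (0 : ℝ) ≤ notDeepCount 64 (3 / 50) (1 / 450) y := Nat.cast_nonneg _
    have n7 : (0 : ℝ) ≤ guardBadCount G δ y := Nat.cast_nonneg _
    push_cast
    linarith [mul_nonneg hKa0 n1, mul_nonneg hKa0 n2, mul_nonneg hKa0 n3, mul_nonneg hKa0 n4, mul_nonneg hKa0 n5, mul_nonneg hKa0 n6,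
      mul_nonneg hKa0 n7, mul_nonneg hKb0 n1, mul_nonneg hKb0 n2, mul_nonneg hKb0 n3, mul_nonneg hKb0 n4, mul_nonneg hKb0 n5, mul_nonneg hKb0 n6,
      mul_nonneg hKb0 n7]
  -- return to depth 64
  rw [balancedAffMidGapW_iff_censusW]
  have hLp0 : 0 ≤ L + 128 / δ := by linarith
  set K₁ : ℝ := 27 / δ ^ 3 * (2 * (L + 128 / δ) * 2 + δ) ^ 3 with hK₁
  have hK₁0 : 0 ≤ K₁ := by
    rw [hK₁]; exact mul_nonneg (div_nonneg (by norm_num) (pow_nonneg hδ.le 3)) (pow_nonneg (by linarith) 3)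
  refine censusW_of_le_mul_add (K := K₁) hK₁0 (fun y hy => ?_) hW
  have h1n := affMidCount_depth_le (ρ := 64) (L := L + 128 / δ) (ρ₁ := 12) (ε₁ := 1 / 10 ^ 4) (θ := 1 / 25) (ε := 3 / 50) (g := 1 / 450) y
  have h1 : (affMidCount 64 12 (1 / 10 ^ 4) (1 / 25) (3 / 50) (1 / 450) y : ℝ) ≤
      (affMidCount (L + 128 / δ) 12 (1 / 10 ^ 4) (1 / 25) (3 / 50) (1 / 450) y : ℝ) + (notDeepCount (L + 128 / δ) (3 / 50) (1 / 450) y : ℝ) := by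
    exact_mod_cast h1n
  have h2 := notDeepCount_depth_le (ρ := 64) (L := L + 128 / δ) (ε := 3 / 50) (g := 1 / 450) (σ₁ := δ) (σ₂ := 2)
    (by norm_num) hLp0 hδ hδ2 hy
  rw [← hK₁] at h2
  linarith

/-- **`CoarseMid ⟸ AgitGain ∧ DilatedDeepT t ∧ SoftGain ∧ StableRigidity t ∧ LooseCalm ∧ OpticCalm`** (`t ≤ 21/20`).  Per window: `η₂ := min ηL ηO`,
stable-guard dials `(τ₀, κ, Ls, L₀)` from `StableRigidity t` at `η₂`; the guard-bad sites are dilated past `t` (paid by `DilatedDeepT t`) or locally unstable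
(paid by `SoftGain` at `(κ, Ls)`); (413)'s dilated sites (`nn > 21/20 ≥ t`) are dilated past `t`. [this node] -/
theorem coarseMid_of_stable_pieces {t : ℝ} (ht : t ≤ 21 / 20) (hAg : AgitGain) (hDi : DilatedDeepT t) (hSo : SoftGain)
    (hR : StableRigidity t) (hLo : LooseCalm) (hOp : OpticCalm) : CoarseMid := by
  intro δ hδ hδ2
  obtain ⟨ηL, τL, LL, hηL, hτL, hbandL⟩ := hLo δ hδ hδ2
  obtain ⟨ηO, τO, LO, hηO, hτO, hbandO⟩ := hOp δ hδ hδ2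
  obtain ⟨τ₀, κ, Ls, L₀, hτ₀, hκ, hLs, hL₀, hrig⟩ := hR δ hδ hδ2 (min ηL ηO) (lt_min hηL hηO)
  have hGb : CensusW (fun y => guardBadCount (StableGuard t δ κ Ls) δ y) (fun y => notDeepCount 64 (3 / 50) (1 / 450) y) δ 2 :=
    censusW_mono (fun y => guardBadCount_stable_le t δ κ Ls y) (fun _ => le_rfl) (censusW_add (hDi δ hδ hδ2) (hSo δ hδ hδ2 κ Ls hκ hLs))
  have hDi' : CensusW (fun y => dilatedCount δ y) (fun y => notDeepCount 64 (3 / 50) (1 / 450) y) δ 2 :=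
    censusW_mono (fun y => dilatedCount_le_dilatedTCount ht δ y) (fun _ => le_rfl) (hDi δ hδ hδ2)
  exact affMidGapW_of_guard hδ hδ2 hτ₀ hL₀ hτL hτO (min_le_left _ _) (min_le_right _ _) hrig hbandL hbandO
    (fun τ hτ => hAg δ hδ hδ2 τ hτ) hDi' hGb

/-- **`CoarseMid ⟸ AgitGain ∧ DilatedDeepT t ∧ CalmRigidityT t ∧ LooseCalm ∧ OpticCalm`** (`t ≤ 21/20`; first-order variant: the tight guard's bad sites
are dilated past `t`). [this node] -/
theorem coarseMid_of_tight_pieces {t : ℝ} (ht : t ≤ 21 / 20) (hAg : AgitGain) (hDi : DilatedDeepT t) (hR : CalmRigidityT t)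
    (hLo : LooseCalm) (hOp : OpticCalm) : CoarseMid := by
  intro δ hδ hδ2
  obtain ⟨ηL, τL, LL, hηL, hτL, hbandL⟩ := hLo δ hδ hδ2
  obtain ⟨ηO, τO, LO, hηO, hτO, hbandO⟩ := hOp δ hδ hδ2
  obtain ⟨τ₀, L₀, hτ₀, hL₀, hrig⟩ := hR δ hδ hδ2 (min ηL ηO) (lt_min hηL hηO)
  have hGb : CensusW (fun y => guardBadCount (TightGuard t) δ y) (fun y => notDeepCount 64 (3 / 50) (1 / 450) y) δ 2 :=
    censusW_mono (fun y => guardBadCount_tight_le t δ y) (fun _ => le_rfl) (hDi δ hδ hδ2)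
  have hDi' : CensusW (fun y => dilatedCount δ y) (fun y => notDeepCount 64 (3 / 50) (1 / 450) y) δ 2 :=
    censusW_mono (fun y => dilatedCount_le_dilatedTCount ht δ y) (fun _ => le_rfl) (hDi δ hδ hδ2)
  exact affMidGapW_of_guard hδ hδ2 hτ₀ hL₀ hτL hτO (min_le_left _ _) (min_le_right _ _) hrig hbandL hbandO
    (fun τ hτ => hAg δ hδ hδ2 τ hτ) hDi' hGb

/-- **RECORD INSTANCE `t = 1`: `CoarseMid ⟸ AgitGain ∧ DilatedDeepT 1 ∧ SoftGain ∧ StableRigidity 1 ∧ LooseCalm ∧ OpticCalm`.** [this node] -/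
theorem coarseMid_of_stable_pieces_one (hAg : AgitGain) (hDi : DilatedDeepT 1) (hSo : SoftGain) (hR : StableRigidity 1) (hLo : LooseCalm)
    (hOp : OpticCalm) : CoarseMid :=
  coarseMid_of_stable_pieces (by norm_num) hAg hDi hSo hR hLo hOp

-- (landing-lane DEDUP edition, hand-2 g49: the consistency re-derivation `coarseMid_of_calm_pieces'` — statement identical to the landed (413)
-- `…AffineCalmDescent.coarseMid_of_pieces` — is omitted by the gate's dedup rule; its one-line proof was
-- `coarseMid_of_tight_pieces le_rfl hAg (dilatedDeepT_of_dilatedDeep hDi) (calmRigidityT_of_calmRigidity (21 / 20) hR) hLo hOp`.)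

/-! ## §8  The record seam and the cone with `CalmRigidity` ABSENT (record instance `t = 1`) -/

/-- **THE RECORD SEAM through the stable descent:
`InterfaceDominance ⟸ SW♭₃₀ ∧ MildBand ∧ StrongBand ∧ (AgitGain ∧ DilatedDeepT 1 ∧ SoftGain ∧ StableRigidity 1 ∧ LooseCalm ∧ OpticCalm) ∧ ThinFault`.** [this node] -/
theorem interfaceDominance_of_swapWide30_stable (hT : StackSwapGainFlatWide30) (hMi : MildBand) (hSt : StrongBand)
    (hAg : AgitGain) (hDi : DilatedDeepT 1) (hSo : SoftGain) (hR : StableRigidity 1) (hLo : LooseCalm) (hOp : OpticCalm) (hF : ThinFault) :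
    InterfaceDominance :=
  interfaceDominance_of_swapWide30_bands hT hMi hSt (coarseMid_of_stable_pieces_one hAg hDi hSo hR hLo hOp) hF

/-- **RDEF of record through the stable descent** (tree cone `rdef_of_ceg_shape_strainBand_record` BY NAME, its `CoarseMid` leaf discharged from the six
pieces at `t = 1`; `CalmRigidity` does not occur). [this node] -/
theorem rdef_of_ceg_shape_stableDescent_record
    (hCEG : Summit.AtomisticToContinuum.Crystallization.Theses.PricedLinkCensus.ChargedEnergyGap)
    (hSh : OverbindingBudgetTwoShellShape.TwoShellShape (1 / 100) (3 / 50) (1 / 450))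
    (hQH : TameBalancedHexRoughGap 64 12 (1 / 10 ^ 5) (1 / 25) (3 / 50) (1 / 450) 12) (hQ : RoughCubic)
    (hT : StackSwapGainFlatWide30) (hMi : MildBand) (hSt : StrongBand)
    (hAg : AgitGain) (hDi : DilatedDeepT 1) (hSo : SoftGain) (hR : StableRigidity 1) (hLo : LooseCalm) (hOp : OpticCalm) (hF : ThinFault)
    (hK : ∃ μ₁ μR : ℝ, 0 < μ₁ ∧ 0 < μR ∧ OverbindingBudgetAffineNearCluster.PureMarginStabilityAt (3 / 2000) μ₁ μR 4)
    (hA : AffineChartStraightening)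
    (hE : OverbindingBudgetAffineNearCluster.NearLightSkeletonEquilibrium (3 / 2000) 4 6 (1 / 1000) 12 (1 / 25) (1 / 2000) 4 6 320 12)
    (hCF : OverbindingBudgetAffineNearCluster.NearPricedCoreFloor (3 / 2000) 4 6 (1 / 1000) 12 (1 / 25) (1 / 2000) (1 / (4 * 10 ^ 7) / 4) 4 6 12)
    (hSF : OverbindingBudgetAffineNearCluster.NearPricedShellFloor (3 / 2000) 4 6 (1 / 1000) 12 (1 / 25) (1 / 2000) (1 / (4 * 10 ^ 7) / 4) 4 6 12)
    (hV : OverbindingBudgetAffineNearCluster.ForceContentVisible (3 / 2000) 4 6 (1 / 1000) 12 (1 / 25) (1 / 2000) 4 6)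
    (hN : OverbindingBudgetAffineNearCluster.NearSecondOrderFloor (3 / 2000) 4 6 (1 / 1000) 12 (1 / 25) (1 / 2000) (1 / (4 * 10 ^ 7)))
    (hFA : OverbindingBudgetAffineLocalisation.FarAggregatePricing 12 (1 / 25) (1 / 2000) (1 / (2 * 10 ^ 7)))
    (hFR : FineNonAffinity 12 (1 / 10 ^ 5) (1 / 25))
    (hTT : OverbindingBudgetGradedBareness.CleanlessExcessT) (hRR : OverbindingBudgetCoherentCut.CoherentResidual 10) :
    Summit.AtomisticToContinuum.Crystallization.Theses.OverbindingBudget.RobustDefectLimitWindows :=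
  rdef_of_ceg_shape_strainBand_record hCEG hSh hQH hQ hT hMi hSt (coarseMid_of_stable_pieces_one hAg hDi hSo hR hLo hOp) hF hK hA hE hCF hSF hV
    hN hFA hFR hTT hRR

/-- In the cone, `DilatedDeepT 1` is no new strength: it follows from the APEX scale census TBDSG at the record depth `ρ = 4`
(`(122/125)(51/50) = 0.99552 ≤ 1`).  (TBDSG is not a leaf — this is a certificate, not a discharge.) [this node] -/
theorem dilatedDeepT_one_of_tbdsg_record (h : TameBalancedDeepScaleGap (122 / 125) 0 4 (3 / 50) (1 / 450)) : DilatedDeepT 1 :=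
  dilatedDeepT_of_tbdsg (by norm_num) (by norm_num) h

end Summit.AtomisticToContinuum.Crystallization.Theorems.OverbindingBudgetAffineStableDescent
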